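/-
Copyright (c) 2026. All rights reserved.
Released under Apache 2.0 license as described in the file LICENSE.
Authors: HodgeCM publication cell (pub-hodgecm), GR lane, seat GR-2 (`pub-hodgecm-own-hyp34`).
-/
import Literature.NumberTheory.GelbartRogawski1991.DoubledWeilRepresentationArchHalfGen
import Literature.NumberTheory.Weil1964.ArchUnitaryWeilHalf3Lift
import Literature.NumberTheory.Automorphic.QuadExtPlacesAbove
import HarnessLib

/-!
# The doubled Weil representation over a GENERAL quadratic `E/F`: the archimedean half from the three-block section,
# modulo the parabolic prescription

Sequel of `DoubledWeilRepresentationArchHalfGen` (`E` totally complex) for an ARBITRARY quadratic extension of number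
fields `E/F` (real places of `F` of both types (i) `E_v = ℂ` and (ii) `E_v = ℝ × ℝ`, and complex places).  The
archimedean section is the three-block `Weil1964.archWeilHalf3` (type (i): Folland–Paul `U(p,q)` section; type (ii)
and complex: conjugated Siegel–Levi sections) at the CANONICAL place data of `QuadExtPlacesAbove`
(`IsTypeOne`, `placeAboveOne`, `placeAboveTwo`, `placeAboveComplex`) and the doubled diagonal Gram data
`T^𝔻 = diag(t₀^𝔻)` (`t₀D`, `gramD_eq_diagonal_gen`):

* **`archWeilHalf3D x₂ hx₂ x₃ hx₃`** (a transparent abbreviation) — `s_∞ : H(F ⊗ ℝ) →* Mp(𝕎^𝔻)ᶜᵒⁿᵗ` over `ι^𝔻 ∘ (·, 1)`,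
  with the three `ALift` binders `archWeilHalf3D_hfin`, `archWeilHalf3D_hdict`, `archWeilHalf3D_eq_archLift` (`hsa`, `rfl`), so that
  `DoubledWeilRepresentationArchLiftGen`/`…ArchLiftSigns` apply verbatim with `eW := frame3D`, `sW := archWeilSection3D`;
* **`isArchHalf_twist_archWeilHalf3D`**: for every continuous character `η` of `H(F ⊗ ℝ)`, IF the twist `s_∞ ⊗ η` has
  the prescribed origin values on `P_Δ(F ⊗ ℝ)` (`ParabolicPrescribed`, the one remaining input at the type-(ii)
  places — `DoubledWeilRepresentationArchLiftGen.parabolicPrescribed_twist` covers `E` totally complex), THEN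
  `s_∞ ⊗ η` is an archimedean half: `IsArchHalf χ (s_∞ ⊗ η)` (`isArchHalf_twist` with the three structural fields
  `continuous_archWeilHalf3`, `proj_archWeilHalf3`, `isArch_archWeilHalf3`);
* `exists_archWeilHalf3D_lifts` (the lifts `x₂`, `x₃` exist) and the quotient character of the underlying section
  (`quot_archWeilSection3`: `∏_{(i)} (det g_{w₁(v)})⁻¹ · ∏_{(ii)} sgn det g_{w₂(v)}`) for the squares identity.

Topic `NumberTheory/GelbartRogawski1991`; namespace `…GRConstructionGen`.  KERNEL only: one transparent abbreviation and
theorems; no `def … : Prop`, no named fact, no `sorry`.  Written for the stage-1 cell `pub-hodgecm` (GR lane); nothing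
here is a claim of the manuscripts adjudicated by that cell; `HC_CM` is not touched.

## References
* S. Gelbart, J. Rogawski, Invent. Math. 105 (1991), §3.1 Prop. 3.1.1 p. 455 [GelbartRogawski1991].
* S. S. Kudla, Israel J. Math. 87 (1994), §3 [Kudla1994].
* M. Harris, S. S. Kudla, W. J. Sweet, J. Amer. Math. Soc. 9 (1996), §1 (1.9), (1.15) [HarrisKudlaSweet1996].
-/

set_option autoImplicit false

noncomputable section

open scoped Classical
open scoped Matrix Kronecker TensorProduct
open NumberField NumberField.InfinitePlace IsDedekindDomain
open Literature.RepresentationTheory.HeisenbergGroup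
open Literature.NumberTheory.Automorphic Literature.NumberTheory.Automorphic.UnitaryGroup
open Literature.NumberTheory.Weil1964
open Literature.NumberTheory.GaloisRepresentations
open Literature.Analysis.SegalBargmann

namespace Literature.NumberTheory.GelbartRogawski1991.GRConstructionGen

open UnitaryDualPair

variable (F : Type) [Field F] [NumberField F] (E : Type) [Field E] [NumberField E] [Algebra F E]
  [Algebra.IsQuadraticExtension F E]
variable (c : E ≃ₐ[F] E) {δ : E} (hcδ : c δ = -δ) (hδ : δ ≠ 0) {d : F} (hd : δ * δ = algebraMap F E d)
variable {N M n : ℕ} (e : Fin N × Fin M ≃ Fin n)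
  (dV : Fin N → F) (hV : (Matrix.diagonal dV).IsSymm) (hVd : IsUnit (Matrix.diagonal dV).det) (hdV0 : ∀ i, dV i ≠ 0)
  (dW : Fin M → F) (hW : (Matrix.diagonal dW).IsSymm) (hWd : IsUnit (Matrix.diagonal dW).det) (hdW0 : ∀ j, dW j ≠ 0)

/-! ## §1 The three-block archimedean section at the doubled data -/

/-- the framed split Cayley family of the doubled data at the type-(ii) real places (lift condition for `x₂`).
[cite: Kudla1994, §3] -/
abbrev rsCayley3D (k : {v : {v : InfinitePlace F // v.IsReal} // ¬ IsTypeOne F E v}) :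
    symplecticGroup (polar (dotPairing (Fin (n + n)))) :=
  rsCayley3 E (n + n) (IsTypeOne F E) (placeAboveTwo F E) (t₀D F e dV dW) (t₀D_ne_zero F e dV hdV0 dW hdW0) hδ k

/-- the realified complex Cayley family of the doubled data at the complex places (lift condition for `x₃`).
[cite: Kudla1994, §3] -/
abbrev cxKappa3D (v : {v : InfinitePlace F // v.IsComplex}) : symplecticGroup (polar (dotPairing (Fin (n + n) ⊕ Fin (n + n)))) :=
  cxKappaFamily F E (n + n) (gramD F e (Matrix.diagonal dV) (Matrix.diagonal dW))
    (isSymm_of_diagonal (n + n) (t₀D F e dV dW) (gramD_eq_diagonal_gen F e dV dW))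
    (isUnit_det_of_diagonal (n + n) (t₀D F e dV dW) (t₀D_ne_zero F e dV hdV0 dW hdW0) (gramD_eq_diagonal_gen F e dV dW))
    hδ (placeAboveComplex F E) v

variable (x₂ : MpS (Fin (n + n) × {v : {v : InfinitePlace F // v.IsReal} // ¬ IsTypeOne F E v}))
  (hx₂ : MpS.proj x₂ = placeSp fun k => (rsCayley3D F E e dV hdV0 dW hdW0 (hδ := hδ) k)⁻¹)
  (x₃ : MpS ((Fin (n + n) ⊕ Fin (n + n)) × {v : InfinitePlace F // v.IsComplex}))
  (hx₃ : MpS.proj x₃ = placeSp fun v => (cxKappa3D F E e dV hdV0 dW hdW0 (hδ := hδ) v)⁻¹)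

/-- **`archWeilSection3D x₂ x₃ : H(F ⊗ ℝ) →* Mp^𝓢(ℝ^{FrameIdx})`** — the three-block archimedean Weil section of the
doubled unitary group `H = U(J^𝔻)` at the canonical place data. [cite: GelbartRogawski1991, §3.1 Prop. 3.1.1 p. 455; Kudla1994, §3] -/
abbrev archWeilSection3D : UnitaryGroup.arch F E c (n + n) (hermD F E e (Matrix.diagonal dV) (Matrix.diagonal dW)) →*
    MpS (FrameIdx F (Fin (n + n))) :=
  archWeilSection3 E c (n + n) (LocalSplitting.galConj_ne_one_of_delta F E c hcδ hδ)
    (AlgEquiv.ext (LocalSplitting.galConj_apply_apply F E c hcδ hδ)) (IsTypeOne F E) (placeAboveOne F E)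
    (smul_placeAboveOne F E c) (placeAboveOne_comap F E) (placeAboveTwo F E) (placeAboveComplex F E) (t₀D F e dV dW)
    (t₀D_ne_zero F e dV hdV0 dW hdW0) (gramD_eq_diagonal_gen F e dV dW) rfl hcδ hδ x₂ x₃

/-- **`archWeilHalf3D x₂ hx₂ x₃ hx₃ : H(F ⊗ ℝ) →* Mp(𝕎^𝔻)ᶜᵒⁿᵗ`** — its archimedean lift over `ι^𝔻 ∘ (·, 1)`.
[cite: GelbartRogawski1991, §3.1 Prop. 3.1.1 p. 455; Weil1964, Chap. III n° 37–39] -/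
abbrev archWeilHalf3D : UnitaryGroup.arch F E c (n + n) (hermD F E e (Matrix.diagonal dV) (Matrix.diagonal dW)) →*
    MpD F e (Matrix.diagonal dV) (Matrix.diagonal dW) :=
  archWeilHalf3 E c (n + n) (LocalSplitting.galConj_ne_one_of_delta F E c hcδ hδ)
    (AlgEquiv.ext (LocalSplitting.galConj_apply_apply F E c hcδ hδ)) (IsTypeOne F E) (placeAboveOne F E)
    (smul_placeAboveOne F E c) (placeAboveOne_comap F E) (placeAboveTwo F E) (placeAboveTwo_comap F E) (placeAboveComplex F E)
    (placeAboveComplex_comap F E) (t₀D F e dV dW) (t₀D_ne_zero F e dV hdV0 dW hdW0) (gramD_eq_diagonal_gen F e dV dW) rfl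
    hcδ hδ hd x₂ hx₂ x₃ hx₃ (isUnit_archMat_gramDA F e _ hVd _ hWd)

/-- the Folland frame of `𝕎^𝔻_∞` at the canonical place data (abbreviation). [cite: Kudla1994, §3] -/
abbrev frame3D : (Fin (n + n) → mixedEmbedding.mixedSpace F) ≃L[ℝ] (FrameIdx F (Fin (n + n)) → ℝ) :=
  frame3 E c (n + n) (LocalSplitting.galConj_ne_one_of_delta F E c hcδ hδ) (IsTypeOne F E) (placeAboveOne F E)
    (smul_placeAboveOne F E c) (placeAboveComplex F E) (placeAboveComplex_comap F E) (t₀D F e dV dW)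
    (t₀D_ne_zero F e dV hdV0 dW hdW0) hcδ hδ

include hV hW in
/-- **the `hfin` binder of `DoubledWeilRepresentationArchLiftGen` for `sa := archWeilHalf3D`**: `ι^𝔻(g, 1)` fixes the finite
vectors. [cite: GelbartRogawski1991, §3.1 Prop. 3.1.1 p. 455] -/
theorem archWeilHalf3D_hfin (g : UnitaryGroup.arch F E c (n + n) (hermD F E e (Matrix.diagonal dV) (Matrix.diagonal dW)))
    (k k' : Fin (n + n) → FiniteAdeleRing (𝓞 F) F) :
    (((toSpD F E c hcδ hδ hd e (Matrix.diagonal dV) hV (Matrix.diagonal dW) hW).comp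
      (UnitaryGroup.archToAdelic F E c (n + n) (hermD F E e (Matrix.diagonal dV) (Matrix.diagonal dW)))) g).1
        (finVec k, finVec k') = (finVec k, finVec k') :=
  adelicToSymplectic_comp_archToAdelic_finVec E c (n + n) (J := hermD F E e (Matrix.diagonal dV) (Matrix.diagonal dW))
    (T := gramD F e (Matrix.diagonal dV) (Matrix.diagonal dW)) rfl hcδ hδ hd (gramD_isSymm F e _ hV _ hW) g k k'

include hV hW hx₂ hx₃ in
/-- **the `hdict` binder for `sa := archWeilHalf3D`**: the frame dictionary of the three-block section at the doubled data.
[cite: GelbartRogawski1991, §3.1 Prop. 3.1.1 p. 455; Kudla1994, §3] -/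
theorem archWeilHalf3D_hdict (g : UnitaryGroup.arch F E c (n + n) (hermD F E e (Matrix.diagonal dV) (Matrix.diagonal dW))) :
    archPhaseMap (gramDA F e (Matrix.diagonal dV) (Matrix.diagonal dW)) (frame3D F E c hcδ hδ e dV hdV0 dW hdW0)
        (isUnit_archMat_gramDA F e _ hVd _ hWd)
        (((toSpD F E c hcδ hδ hd e (Matrix.diagonal dV) hV (Matrix.diagonal dW) hW).comp
          (UnitaryGroup.archToAdelic F E c (n + n) (hermD F E e (Matrix.diagonal dV) (Matrix.diagonal dW)))) g) =
      ⇑((MpS.proj (archWeilSection3D F E c hcδ hδ e dV hdV0 dW hdW0 x₂ x₃ g)).1 :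
        ((FrameIdx F (Fin (n + n)) → ℝ) × (FrameIdx F (Fin (n + n)) → ℝ)) ≃ₗ[ℝ]
          ((FrameIdx F (Fin (n + n)) → ℝ) × (FrameIdx F (Fin (n + n)) → ℝ))) :=
  archPhaseMap_eq_coe_proj_archWeilSection3 E c (n + n) _ _ (IsTypeOne F E) (placeAboveOne F E) (smul_placeAboveOne F E c)
    (placeAboveOne_comap F E) (placeAboveTwo F E) (placeAboveTwo_comap F E) (placeAboveComplex F E) (placeAboveComplex_comap F E)
    (t₀D F e dV dW) _ (gramD_eq_diagonal_gen F e dV dW) rfl hcδ hδ hd x₂ hx₂ x₃ hx₃ _ g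

include hV hW in
/-- **the `hsa` binder**: `archWeilHalf3D = archLift (T^𝔻 ⊗ 1) frame3D … (ι^𝔻 ∘ (·, 1)) archWeilSection3D hfin hdict` (by `rfl`).
[cite: GelbartRogawski1991, §3.1 Prop. 3.1.1 p. 455] -/
theorem archWeilHalf3D_eq_archLift :
    archWeilHalf3D F E c hcδ hδ hd e dV hVd hdV0 dW hWd hdW0 x₂ hx₂ x₃ hx₃ =
      archLift (gramDA F e (Matrix.diagonal dV) (Matrix.diagonal dW)) (frame3D F E c hcδ hδ e dV hdV0 dW hdW0)
        (isUnit_archMat_gramDA F e _ hVd _ hWd)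
        ((toSpD F E c hcδ hδ hd e (Matrix.diagonal dV) hV (Matrix.diagonal dW) hW).comp
          (UnitaryGroup.archToAdelic F E c (n + n) (hermD F E e (Matrix.diagonal dV) (Matrix.diagonal dW))))
        (archWeilSection3D F E c hcδ hδ e dV hdV0 dW hdW0 x₂ x₃)
        (archWeilHalf3D_hfin F E c hcδ hδ hd e dV hV dW hW)
        (archWeilHalf3D_hdict F E c hcδ hδ hd e dV hV hVd hdV0 dW hW hWd hdW0 x₂ hx₂ x₃ hx₃) :=
  rfl

/-! ## §2 The archimedean half modulo the parabolic prescription -/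

include hV hW in
/-- **THE ARCHIMEDEAN HALF OVER A GENERAL QUADRATIC `E/F`, MODULO THE PARABOLIC PRESCRIPTION**: for a Hecke character `χ`
of `E` and a continuous character `η` of `H(F ⊗ ℝ)`, if `s_∞ ⊗ η` (`s_∞ = archWeilHalf3D x₂ hx₂ x₃ hx₃`) has the prescribed
origin values `χ(det_Δ p)|det_Δ p|^{1/2}` on `P_Δ(F ⊗ ℝ)`, then it is an archimedean half: `IsArchHalf χ (s_∞ ⊗ η)`.
[cite: GelbartRogawski1991, §3.1 Prop. 3.1.1 p. 455; HarrisKudlaSweet1996, §1 (1.15)] -/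
theorem isArchHalf_twist_archWeilHalf3D (χ : HeckeCharacter E)
    (η : UnitaryGroup.arch F E c (n + n) (hermD F E e (Matrix.diagonal dV) (Matrix.diagonal dW)) →* ℂˣ)
    (hηc : Continuous fun g => ((η g : ℂˣ) : ℂ))
    (hpar : ParabolicPrescribed F E c e (Matrix.diagonal dV) hVd (Matrix.diagonal dW) hWd
      (UnitaryGroup.archToAdelic F E c (n + n) (hermD F E e (Matrix.diagonal dV) (Matrix.diagonal dW))) χ
      (adelicMpCont.twist F (Fin (n + n)) (gramDA F e (Matrix.diagonal dV) (Matrix.diagonal dW))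
        (archWeilHalf3D F E c hcδ hδ hd e dV hVd hdV0 dW hWd hdW0 x₂ hx₂ x₃ hx₃) η)) :
    IsArchHalf F E c hcδ hδ hd e (Matrix.diagonal dV) hV hVd (Matrix.diagonal dW) hW hWd χ
      (adelicMpCont.twist F (Fin (n + n)) (gramDA F e (Matrix.diagonal dV) (Matrix.diagonal dW))
        (archWeilHalf3D F E c hcδ hδ hd e dV hVd hdV0 dW hWd hdW0 x₂ hx₂ x₃ hx₃) η) := by
  have hc : c ≠ 1 := LocalSplitting.galConj_ne_one_of_delta F E c hcδ hδ
  have hcc : c * c = 1 := AlgEquiv.ext (LocalSplitting.galConj_apply_apply F E c hcδ hδ)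
  have hTd := gramD_eq_diagonal_gen F e dV dW
  have ht0 := t₀D_ne_zero F e dV hdV0 dW hdW0
  exact isArchHalf_twist F E c hcδ hδ hd e (Matrix.diagonal dV) hV hVd (Matrix.diagonal dW) hW hWd
    (UnitaryGroup.archToAdelic F E c (n + n) (hermD F E e (Matrix.diagonal dV) (Matrix.diagonal dW))) rfl
    (frame3 E c (n + n) hc (IsTypeOne F E) (placeAboveOne F E) (smul_placeAboveOne F E c) (placeAboveComplex F E)
      (placeAboveComplex_comap F E) (t₀D F e dV dW) ht0 hcδ hδ)
    (archWeilSection3D F E c hcδ hδ e dV hdV0 dW hdW0 x₂ x₃)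
    (adelicToSymplectic_comp_archToAdelic_finVec E c (n + n)
      (J := hermD F E e (Matrix.diagonal dV) (Matrix.diagonal dW))
      (T := gramD F e (Matrix.diagonal dV) (Matrix.diagonal dW)) rfl hcδ hδ hd (isSymm_of_diagonal (n + n) (t₀D F e dV dW) hTd))
    (archPhaseMap_eq_coe_proj_archWeilSection3 E c (n + n) hc hcc (IsTypeOne F E) (placeAboveOne F E) (smul_placeAboveOne F E c)
      (placeAboveOne_comap F E) (placeAboveTwo F E) (placeAboveTwo_comap F E) (placeAboveComplex F E) (placeAboveComplex_comap F E)
      (t₀D F e dV dW) ht0 hTd rfl hcδ hδ hd x₂ hx₂ x₃ hx₃ (isUnit_archMat_gramDA F e _ hVd _ hWd))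
    (archWeilHalf3D F E c hcδ hδ hd e dV hVd hdV0 dW hWd hdW0 x₂ hx₂ x₃ hx₃) rfl χ
    (continuous_archWeilHalf3 E c (n + n) hc hcc (IsTypeOne F E) (placeAboveOne F E) (smul_placeAboveOne F E c)
      (placeAboveOne_comap F E) (placeAboveTwo F E) (placeAboveTwo_comap F E) (placeAboveComplex F E) (placeAboveComplex_comap F E)
      (t₀D F e dV dW) ht0 hTd rfl hcδ hδ hd x₂ hx₂ x₃ hx₃ (isUnit_archMat_gramDA F e _ hVd _ hWd))
    η hηc hpar

include hdV0 hdW0 in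
/-- **the lifts exist**: `x₂` over the framed split Cayley elements, `x₃` over the realified complex Cayley elements.
[cite: Folland1989, §4.2 Prop. (4.39)] -/
theorem exists_archWeilHalf3D_lifts :
    (∃ x₂ : MpS (Fin (n + n) × {v : {v : InfinitePlace F // v.IsReal} // ¬ IsTypeOne F E v}),
        MpS.proj x₂ = placeSp fun k => (rsCayley3D F E e dV hdV0 dW hdW0 (hδ := hδ) k)⁻¹) ∧
      ∃ x₃ : MpS ((Fin (n + n) ⊕ Fin (n + n)) × {v : InfinitePlace F // v.IsComplex}),
        MpS.proj x₃ = placeSp fun v => (cxKappa3D F E e dV hdV0 dW hdW0 (hδ := hδ) v)⁻¹ :=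
  ⟨MpS.proj_surjective _, MpS.proj_surjective _⟩

/-- **the quotient character of the three-block section of the doubled group**:
`quot (archWeilSection3D x₂ x₃ g) = ∏_{(i)} (det g_{w₁(v)})⁻¹ · ∏_{(ii)} sgn det g_{w₂(v)}` (for the squares identity
of the parabolic prescription). [cite: Folland1989, §4.2 Thm. (4.37); Kudla1994, §3] -/
theorem quot_archWeilSection3D (g : UnitaryGroup.arch F E c (n + n) (hermD F E e (Matrix.diagonal dV) (Matrix.diagonal dW))) :
    MpS.quot (archWeilSection3D F E c hcδ hδ e dV hdV0 dW hdW0 x₂ x₃ g) =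
      (∏ k : {v : {v : InfinitePlace F // v.IsReal} // IsTypeOne F E v},
        ((((archAt F E c (n + n) (hermD F E e (Matrix.diagonal dV) (Matrix.diagonal dW)) (placeAboveOne F E k)
            (smul_placeAboveOne F E c k) (LocalSplitting.galConj_ne_one_of_delta F E c hcδ hδ) g :
            archLocal E (n + n) (hermD F E e (Matrix.diagonal dV) (Matrix.diagonal dW)) (placeAboveOne F E k)) :
            GL (Fin (n + n)) ℂ) : Matrix (Fin (n + n)) (Fin (n + n)) ℂ).det)⁻¹) *
      ∏ k : {v : {v : InfinitePlace F // v.IsReal} // ¬ IsTypeOne F E v},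
        (if 0 < ((((g : GL (Fin (n + n)) (mixedEmbedding.mixedSpace E)) :
            Matrix (Fin (n + n)) (Fin (n + n)) (mixedEmbedding.mixedSpace E))).map (evalR E (placeAboveTwo F E k))).det
          then (1 : ℂ) else -1) :=
  quot_archWeilSection3 E c (n + n) _ _ (IsTypeOne F E) (placeAboveOne F E) (smul_placeAboveOne F E c) (placeAboveOne_comap F E)
    (placeAboveTwo F E) (placeAboveComplex F E) (t₀D F e dV dW) _ _ rfl hcδ hδ x₂ x₃ g

end Literature.NumberTheory.GelbartRogawski1991.GRConstructionGen

end
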